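import Mathlib
import Literature.Topology.FourManifolds.PlanarAchiralWords
import Literature.Topology.FourManifolds.PlanarShadowWalk
import Summits.SmoothPoincare4.SmoothPoincare4.Theorems.ConvexBisectionPlanarAcyclicBisectionRigidityStubK4Lift
import HarnessLib

/-!
# Crux `ConvexBisection.PlanarAcyclicBisectionRigidity`, line Sketch (v3.0) — helper
# `helper_shadow_faithful3`: the `F₂` shadow is FAITHFUL on three holes

Pure algebra on the definitions of `Literature/Topology/FourManifolds/PlanarAchiralWords.lean`
(arc data `ArcData 3` of `Mod(D₃, ∂)`, the round Dehn twists `T_[0,1]^{±1}`, `T_[1,2]^{±1}`,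
`evalWord`) and `PlanarShadowWalk.lean` (the shadow `shadowWord : List PGen → F₂`, the round
sub-alphabet `IsXYGen`), over the landed `…StubK4Lift` (sub-namespace `K4Lift`: the monoid
`ArcData 3`, `Φ : F₂ →* (ArcData 3)ˣ`, `x ↦ T_[0,1]`, `y ↦ T_[1,2]`, and
`evalWord 3 g = Φ (shadowWord g)` on the round sub-alphabet, `K4Lift.evalWord_xy`).  Needed by the
combinatorial stub `stub_walk3`: monodromy equality of two words in the round sub-alphabet only
gives `Φ (shadowWord g) = Φ (shadowWord h)` in the model, and the lever of the line lives in the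
shadow `F₂`, so `Φ` must be injective — the subgroup of the arc-data model generated by `T_[0,1]`
and `T_[1,2]` is FREE on them (sub-namespace `ShadowFaithful3`).

* THE POINT-PUSHING FORMULA (`ShadowFaithful3.push_formula`).  Let `π : F₃ → F₂` kill the middle
  generator and invert the two others, `x₀ ↦ x⁻¹`, `x₁ ↦ 1`, `x₂ ↦ y⁻¹`.  For every `s ∈ F₂` the arc
  datum `Φ s` has trivial permutation, its induced automorphism of `F₃` satisfies `π ∘ (Φ s)_* = π`,
  and its middle arc word projects to `π (u₁ (Φ s)) = s⁻¹`.  Induction on `s`: on the four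
  generators `T_[0,1]^{±1}` (`u₁ = (x₀x₁)^{±1}`, `(Φ s)_*` = conjugation by `x₀x₁` on `x₀, x₁`,
  identity on `x₂`) and `T_[1,2]^{±1}` (`u₁ = (x₁x₂)^{±1}`) this is a computation
  (`ShadowFaithful3.gen_case`); multiplicativity is the composition law of arc data,
  `u₁(φψ) = φ_*(u₁ ψ) · u₁ φ`, whose projection is `π (u₁ ψ) · π (u₁ φ) = t⁻¹ s⁻¹ = (st)⁻¹`.
  Geometrically: `u₁` is the arc from the outer boundary to the hole `1`, which lies inside both
  curves `c_[0,1]`, `c_[1,2]`; filling the hole `1` by a marked point and forgetting it kills both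
  twists, and `u₁` read in `π₁(D₂) = F₂` is the point-pushing path of the Birman exact sequence —
  here an identity of explicit arc data, nothing is cited as a fact.
* FAITHFULNESS (`ShadowFaithful3.Φ_injective`, and the registered `helper_shadow_faithful3`):
  `Φ s = Φ t ⇒ s⁻¹ = π (u₁ (Φ s)) = π (u₁ (Φ t)) = t⁻¹`; with `K4Lift.evalWord_xy`, equal arc data
  of two words in the round sub-alphabet force equal shadows.

Uses nothing unproved.
-/

noncomputable section

-- the prescribed namespace `Summit.<S>.<P>.…` repeats `SmoothPoincare4` (S = P = SmoothPoincare4)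
set_option linter.dupNamespace false

open Literature.Topology.FourManifolds Literature.Topology.FourManifolds.PlanarWords
open Literature.Topology.FourManifolds.PlanarShadow

namespace Summit.SmoothPoincare4.SmoothPoincare4.Theorems.PlanarAcyclicBisectionRigidity.Sketch

-- the monoid `ArcData n` of `…StubK4Lift` (the instance carried by the type of `K4Lift.Φ`)
attribute [local instance] K4Lift.arcMonoid

namespace ShadowFaithful3

open K4Lift

/-- Notation: the point-pushing projection `π : F₃ → F₂`, `x₀ ↦ x⁻¹`, `x₁ ↦ 1`, `x₂ ↦ y⁻¹`. -/
local notation "πy" => (FreeGroup.lift ![(FreeGroup.of (0 : Fin 2))⁻¹, (1 : FreeGroup (Fin 2)),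
  (FreeGroup.of (1 : Fin 2))⁻¹] : FreeGroup (Fin 3) →* FreeGroup (Fin 2))

/-- Functoriality of the induced automorphism, in monoid notation (`K4Lift.aut_mul`). [folklore] -/
theorem aut_mul' (φ ψ : ArcData 3) : (φ * ψ).aut = φ.aut.comp ψ.aut := aut_mul φ ψ

/-- `Φ x = T_[0,1]`, `Φ y = T_[1,2]` as arc data. [folklore] -/
theorem Φ_of_val (i : Fin 2) : ((Φ (FreeGroup.of i) : (ArcData 3)ˣ) : ArcData 3) =
    PGen.data 3 (PGen.round i.val (i.val + 1) false) := by
  fin_cases i <;> simp [Φ, uT, FreeGroup.lift_apply_of]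

/-- `Φ x⁻¹ = T_[0,1]⁻¹`, `Φ y⁻¹ = T_[1,2]⁻¹` as arc data. [folklore] -/
theorem Φ_of_inv_val (i : Fin 2) : ((Φ (FreeGroup.of i)⁻¹ : (ArcData 3)ˣ) : ArcData 3) =
    PGen.data 3 (PGen.round i.val (i.val + 1) true) := by
  fin_cases i <;> simp [Φ, uT, FreeGroup.lift_apply_of]

/-- The point-pushing formula on the four generators `T_[0,1]^{±1}`, `T_[1,2]^{±1}`: trivial
permutation, `π ∘ T_* = π`, and `π (u₁) = (x^{±1})⁻¹`, resp. `(y^{±1})⁻¹` (a computation of arc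
words). [folklore] -/
theorem gen_case (i : Fin 2) (s : Bool) :
    (PGen.data 3 (PGen.round i.val (i.val + 1) s)).perm = 1 ∧
    (πy).comp (PGen.data 3 (PGen.round i.val (i.val + 1) s)).aut = πy ∧
    πy ((PGen.data 3 (PGen.round i.val (i.val + 1) s)).u 1) =
      (if s then FreeGroup.of i else (FreeGroup.of i)⁻¹) := by
  refine ⟨rfl, FreeGroup.ext_hom _ _ fun j => ?_, ?_⟩
  · fin_cases i <;> fin_cases j <;> cases s <;> simp [unf, FreeGroup.lift_apply_of]
  · fin_cases i <;> cases s <;> simp [unf, FreeGroup.lift_apply_of]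

/-- **THE POINT-PUSHING FORMULA.**  For every `s ∈ F₂` the arc datum `Φ s` has trivial
permutation, its induced automorphism of `F₃` satisfies `π ∘ (Φ s)_* = π`, and its middle arc word
projects to `π (u₁ (Φ s)) = s⁻¹` (induction on `s`; the product step is the composition law
`u₁(φψ) = φ_*(u₁ ψ) · u₁ φ`). [folklore] -/
theorem push_formula (s : F₂) :
    ((Φ s : (ArcData 3)ˣ) : ArcData 3).perm = 1 ∧
    (πy).comp ((Φ s : (ArcData 3)ˣ) : ArcData 3).aut = πy ∧
    πy (((Φ s : (ArcData 3)ˣ) : ArcData 3).u 1) = s⁻¹ := by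
  refine FreeGroup.induction_on s ?_ (fun i => ?_) (fun i _ => ?_) (fun x y hx hy => ?_)
  · rw [map_one, Units.val_one]
    refine ⟨rfl, FreeGroup.ext_hom _ _ fun j => ?_, ?_⟩
    · simp [unf]
    · simp [unf]
  · rw [Φ_of_val]
    simpa using gen_case i false
  · rw [Φ_of_inv_val, inv_inv]
    simpa using gen_case i true
  · obtain ⟨hx1, hx2, hx3⟩ := hx
    obtain ⟨hy1, hy2, hy3⟩ := hy
    rw [map_mul, Units.val_mul]
    refine ⟨by rw [unf.1, hx1, hy1, mul_one], ?_, ?_⟩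
    · rw [aut_mul', ← MonoidHom.comp_assoc, hx2, hy2]
    · rw [unf.2.1, map_mul, hy1, Equiv.Perm.one_apply, hx3, ← MonoidHom.comp_apply, hx2, hy3,
        mul_inv_rev]

/-- **`Φ : F₂ →* (ArcData 3)ˣ` is injective**: the subgroup of the arc-data model of `Mod(D₃, ∂)`
generated by the round twists `T_[0,1]`, `T_[1,2]` is free on them (read `s⁻¹ = π (u₁ (Φ s))` off
the arc data). [folklore] -/
theorem Φ_injective : Function.Injective Φ := fun s t h =>
  inv_injective <| ((push_formula s).2.2.symm.trans (by rw [h])).trans (push_formula t).2.2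

end ShadowFaithful3

/-- **Helper `helper_shadow_faithful3` (line Sketch v3.0, for `stub_walk3`) — the `F₂` shadow is
FAITHFUL on three holes.**  Two words in the round sub-alphabet `{T_[0,1]^{±1}, T_[1,2]^{±1}}` with
the same arc data on the disc with three holes have the same shadow in `F₂`: by
`K4Lift.evalWord_xy` both arc data are `Φ` of the shadows, and `Φ` is injective
(`ShadowFaithful3.Φ_injective`, the point-pushing formula `π (u₁ (Φ s)) = s⁻¹`). [folklore] -/
theorem helper_shadow_faithful3 (g h : List PGen) (hg : ∀ q ∈ g, IsXYGen q)
    (hh : ∀ q ∈ h, IsXYGen q) (heq : evalWord 3 g = evalWord 3 h) :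
    shadowWord g = shadowWord h := by
  rw [K4Lift.evalWord_xy hg, K4Lift.evalWord_xy hh] at heq
  exact ShadowFaithful3.Φ_injective (Units.ext heq)

end Summit.SmoothPoincare4.SmoothPoincare4.Theorems.PlanarAcyclicBisectionRigidity.Sketch

end
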